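/-
Copyright (c) 2026 the pub-hodgecm-mathlib formalisation cell (harness21).  Prover seat hodgecm-mathlib-K2E3-p03 (g6), Track B «K2-LIT» ∕ h413
(`stmt-HodgeConjecture-24833`), line `K2_E3_EllipticInputs`, road (11-3-split-nsc), leaf (nsc-S-A′) `sig_K2E3GL3PrincipalBlockStandardSpan` (owner K2E3-p25),
line «IH-x×x×x» (lead K2E3-p03 (g6) by D78; dealer K2E3-plan (g4)), brick IH-5 (closing file): `x × x × x` IS IRREDUCIBLE ON `GL₃(F)`.  2026-09-04.
-/
import Summits.HodgeConjecture.HodgeConjecture.Theorems.K2E3GL3IwahoriEndomorphismScalar   -- ★ IH-2d (this seat): `End_G(1×1×1)` is scalar on `I^{Iw}`; brings ★ IH-1∕2a∕2b∕2c, ★ IH-4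
import Summits.HodgeConjecture.HodgeConjecture.Theorems.K2E3GL3IwahoriFixedOfJacquet       -- ★ IH-3 (K2E3-p11 (g7)): `exists_ne_zero_mem_fixedPoints_iwahori`
import Literature.NumberTheory.Automorphic.UnitaryInductionCompleteReducibility            -- ★ `isSemisimpleRepresentation_parabolicIndGL_twist` (unitarity ⇒ complete reducibility)
import Literature.NumberTheory.Automorphic.Zelevinsky1980.InducedMaximalParabolicEndomorphisms  -- ★ `isIrreducible_of_forall_intertwiningMap_of_exists_isCompl`
import Literature.NumberTheory.Automorphic.SmoothInductionCharacterTwist                   -- ★ `SmoothInd.exists_linearEquiv_twist` (`θ ⊗ Ind σ ≅ Ind (σ ⊗ θ|_H)`)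
import Literature.NumberTheory.Automorphic.IrreducibleClasses                              -- ★ `isIrreducible_twist_iff`, `Equiv.isIrreducible_iff`
import Literature.NumberTheory.Automorphic.SmoothCharacterOfCharacter                      -- ★ `isAdmissible_trivial_twist`
import HarnessLib

/-!
# K2_E3 road (h413), leaf (nsc-S-A′), line «IH-x×x×x», brick IH-5: the UNITARY PRINCIPAL SERIES `x × x × x = Ind_B^{GL₃(F)}(x∘det ⊗ δ_B^{1∕2})` IS IRREDUCIBLE
# for every smooth character `x` of `F×` — the residue R1 of the exponent calculus (architect `MEMO-H4-residues` §2), exported BY NAME for the H-layer (`hR1`)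

Cell `pub/hodgecm-mathlib` (D-0151), Track B, seat K2E3-p03 (g6), LEAD of line «IH-x×x×x» (dealer D78); architect K2E3-p25 (g0∕g2) §3 head
`isIrreducible_parabolicIndGL_id_three_self (x) (hx : IsOpen x.ker)`.  `--supports stmt-HodgeConjecture-24833 --as helper`; THEOREMS ONLY (no definition ∕ instance ∕ notation ∕
named fact ∕ `sorry`); never imports `Cruxes/…/Lines`.  COUNT-NEUTRAL helper.

THE MATHEMATICS (route (H) of `MEMO-H4-residues` §2, Iwahori–Hecke 6×6) [Borel1976, §3–§4; Casselman1980, §3; IwahoriMatsumoto1965, §3; BernsteinZelevinsky1977, Thm. 5.2 ∕ §7.1;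
Zelevinsky1980, Thm. 4.2 (the segments `{x},{x},{x}` are pairwise unlinked)].
* §1 `χ = 1`: `I = 1 × 1 × 1 = parabolicIndGL F id (𝟙.twist 1)` is IRREDUCIBLE (`isIrreducible_parabolicIndGL_id_three_one`).  (i) `I ≠ 0` (★ IH-1: `dim I^{Iw} = 6`).  (ii) `End_G(I) = ℂ`:
  for an intertwining `T`, ★ IH-2d gives `T = c` on `I^{Iw}`; `D := T − c` is intertwining, its range `W` is a subrepresentation, and every `Iw`-fixed `f = D u ∈ W` vanishes:
  `f = e_{Iw} f = e_{Iw}(T u) − c·e_{Iw} u = T(e_{Iw} u) − c·e_{Iw} u = 0` (★ IH-2b: `e_{Iw}` commutes with `T`; `e_{Iw} u ∈ I^{Iw}`); by ★ IH-3 (`W ≠ ⊥ ⇒ W` has a non-zero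
  `Iw`-fixed vector — Jacquet's first lemma at Iwahori level) `W = ⊥`, i.e. `T = c`.  (iii) COMPLETE REDUCIBILITY: `1` is unitary with open kernel, ★
  `isSemisimpleRepresentation_parabolicIndGL_twist`.  (iv) ★ `isIrreducible_of_forall_intertwiningMap_of_exists_isCompl`.
* §2 any `x` with open kernel: `θ := x ∘ det` has open kernel and `(𝟙.twist 1 ∘ levi ⊗ δ^{1∕2}) ⊗ θ|_B = (𝟙.twist (tch (x,x,x)) ∘ levi) ⊗ δ^{1∕2}` (`det b = b₀₀ b₁₁ b₂₂` on `B`), so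
  ★ `SmoothInd.exists_linearEquiv_twist` is a `G`-equivalence `(1×1×1) ⊗ θ ≅ x×x×x`; twisting and equivalence preserve irreducibility (★ `isIrreducible_twist_iff`, ★
  `Equiv.isIrreducible_iff`): **`isIrreducible_parabolicIndGL_id_three_self`** — the architect's §3 head, `tch θ = ∏_a (θ a) ∘ det ∘ ev_a` spelled as in ★ E4a ∕ ★ H0-a.
HONEST LABEL: HC_CM is proved only modulo the 7 printed citations (2 remaining named inputs: hLiu418 = stmt-HodgeConjecture-24832, h413 = stmt-HodgeConjecture-24833)
until rung 0 closes; count-neutral helper (it discharges the H-layer's hypothesis `hR1`, not a printed citation).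

## Mathlib ∕ tree search
Tree ★: IH-2d `exists_smul_of_intertwiningMap`, IH-3 `exists_ne_zero_mem_fixedPoints_iwahori`, IH-2b `apply_avgProj_eq_avgProj_apply`∕`avgProj_apply_mem_fixedPoints` (via `avgProj_mem_fixedPoints`),
IH-1 `finrank_fixedPoints_iwahori_three`, `isSemisimpleRepresentation_parabolicIndGL_twist`, `isIrreducible_of_forall_intertwiningMap_of_exists_isCompl`, `SmoothInd.exists_linearEquiv_twist`,
`isIrreducible_twist_iff`, `Equiv.isIrreducible_iff`, `isAdmissible_trivial_twist`, `avgProjLinear`, `avgProj_of_forall_apply_eq`, `det_coe_eq_prod_diag` ∕ `det_fin_one_block` shapes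
(K2E3GL3BorelModulus ∕ H0-a; re-derived inline).  Mathlib: `Representation.Equiv.mk`, `IntertwiningMap.range`, `LinearMap.intertwiningMap_of_isIntertwiningMap`,
`Matrix.GeneralLinearGroup.continuous_det`, `exists_isCompl`.  Dedup: `rg "isIrreducible_parabolicIndGL_id_three"` over `Literature Summits` — no hits.

## References
* [Borel1976] A. Borel, Invent. Math. 35 (1976), §3–§4.  * [Casselman1980] W. Casselman, Compositio Math. 40 (1980), §3.  * [IwahoriMatsumoto1965] Publ. Math. IHÉS 25 (1965), §3.
* [BernsteinZelevinsky1977] I. N. Bernstein, A. V. Zelevinsky, Ann. Sci. ÉNS 10 (1977), 1.9, Thm. 5.2, §7.1.  * [Zelevinsky1980] A. V. Zelevinsky, Ann. Sci. ÉNS 13 (1980), Thm. 4.2.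
-/

set_option autoImplicit false
-- the mandated namespace repeats the single-problem summit's segment (`HodgeConjecture.HodgeConjecture`)
set_option linter.dupNamespace false

noncomputable section

open Matrix
open scoped MatrixGroups
open Literature.NumberTheory.Automorphic ValuativeRel
open Summit.HodgeConjecture.HodgeConjecture.Cruxes.H413

namespace Summit.HodgeConjecture.HodgeConjecture.Cruxes.H413.K2E3GL3UnitaryPrincipalSeriesIrregular

variable {F : Type} [Field F] [ValuativeRel F] [TopologicalSpace F] [IsNonarchimedeanLocalField F]

/-! ## §1 `1 × 1 × 1` is irreducible -/

omit [TopologicalSpace F] [IsNonarchimedeanLocalField F] in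
/-- The trivial character of the diagonal torus of `GL₃` is unramified in ★ IH-1's sense (trivially). [folklore] -/
theorem one_unramified (p : ↥(standardParabolicGL F (id : Fin 3 → Fin 3))) (_hp : (p : GL (Fin 3) F) ∈ glInt 3 F) :
    (1 : (Π a : Fin 3, GL {i : Fin 3 // (id : Fin 3 → Fin 3) i = a} F) →* ℂˣ) (leviProjection F (id : Fin 3 → Fin 3) p) = 1 := rfl

/-- **`1 × 1 × 1 = Ind_B^{GL₃(F)} δ_B^{1∕2}` IS IRREDUCIBLE** (`End = ℂ` by ★ IH-2d + ★ IH-3, complete reducibility by unitarity ★, non-zero by ★ IH-1).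
[cite: Borel1976, §3–§4] [cite: Casselman1980, §3] [cite: BernsteinZelevinskyASENS1977, Thm. 5.2 and §7.1] [cite: Zelevinsky1980, Thm. 4.2] -/
theorem isIrreducible_parabolicIndGL_id_three_one :
    (Representation.parabolicIndGL F (id : Fin 3 → Fin 3)
      ((Representation.trivial ℂ (Π a : Fin 3, GL {i : Fin 3 // (id : Fin 3 → Fin 3) i = a} F) ℂ).twist 1)).IsIrreducible := by
  classical
  have hsm : (Representation.parabolicIndGL F (id : Fin 3 → Fin 3)
      ((Representation.trivial ℂ (Π a : Fin 3, GL {i : Fin 3 // (id : Fin 3 → Fin 3) i = a} F) ℂ).twist 1)).IsSmooth :=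
    Representation.isSmooth_smoothInd _ _
  have hK : IsCompact (iwahoriGL 3 F : Set (GL (Fin 3) F)) := isCompact_iwahoriGL 3 F
  have hKo : IsOpen (iwahoriGL 3 F : Set (GL (Fin 3) F)) := isOpen_iwahoriGL 3 F
  have hχo : IsOpen (((1 : (Π a : Fin 3, GL {i : Fin 3 // (id : Fin 3 → Fin 3) i = a} F) →* ℂˣ).ker :
      Subgroup (Π a : Fin 3, GL {i : Fin 3 // (id : Fin 3 → Fin 3) i = a} F)) : Set (Π a : Fin 3, GL {i : Fin 3 // (id : Fin 3 → Fin 3) i = a} F)) := by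
    rw [MonoidHom.ker_one, Subgroup.coe_top]; exact isOpen_univ
  -- (i) non-zero: `dim I^{Iw} = 6`
  haveI : Nontrivial (Representation.SmoothInd (standardParabolicGL F (id : Fin 3 → Fin 3))
      (Representation.twist (((Representation.trivial ℂ (Π a : Fin 3, GL {i : Fin 3 // (id : Fin 3 → Fin 3) i = a} F) ℂ).twist 1).comp
        (leviProjection F (id : Fin 3 → Fin 3))) (rootDeltaChar (standardParabolicGL F (id : Fin 3 → Fin 3))))) := by
    have h6 := K2E3GL3IwahoriBruhat.finrank_fixedPoints_iwahori_three (F := F) 1 one_unramified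
    have hne : (Representation.parabolicIndGL F (id : Fin 3 → Fin 3)
        ((Representation.trivial ℂ (Π a : Fin 3, GL {i : Fin 3 // (id : Fin 3 → Fin 3) i = a} F) ℂ).twist 1)).fixedPoints (iwahoriGL 3 F) ≠ ⊥ := by
      intro h; rw [h, finrank_bot] at h6; exact absurd h6 (by norm_num)
    obtain ⟨f, -, hf0⟩ := Submodule.exists_mem_ne_zero_of_ne_bot hne
    exact ⟨⟨f, 0, hf0⟩⟩
  -- (ii) `End = ℂ`
  have hEnd : ∀ T : (Representation.parabolicIndGL F (id : Fin 3 → Fin 3)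
      ((Representation.trivial ℂ (Π a : Fin 3, GL {i : Fin 3 // (id : Fin 3 → Fin 3) i = a} F) ℂ).twist 1)).IntertwiningMap
      (Representation.parabolicIndGL F (id : Fin 3 → Fin 3)
        ((Representation.trivial ℂ (Π a : Fin 3, GL {i : Fin 3 // (id : Fin 3 → Fin 3) i = a} F) ℂ).twist 1)), ∃ c : ℂ, ∀ v, T v = c • v := by
    intro T
    obtain ⟨c, hc⟩ := K2E3GL3IwahoriEndomorphismScalar.exists_smul_of_intertwiningMap T
    refine ⟨c, fun v => ?_⟩
    -- `D = T − c` as an intertwining operator and its range `W`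
    let D := (T.toLinearMap - c • LinearMap.id).intertwiningMap_of_isIntertwiningMap
      (Representation.parabolicIndGL F (id : Fin 3 → Fin 3)
        ((Representation.trivial ℂ (Π a : Fin 3, GL {i : Fin 3 // (id : Fin 3 → Fin 3) i = a} F) ℂ).twist 1))
      (Representation.parabolicIndGL F (id : Fin 3 → Fin 3)
        ((Representation.trivial ℂ (Π a : Fin 3, GL {i : Fin 3 // (id : Fin 3 → Fin 3) i = a} F) ℂ).twist 1))
      (fun g w => by
        simp only [LinearMap.sub_apply, LinearMap.smul_apply, LinearMap.id_apply, Representation.IntertwiningMap.toLinearMap_apply,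
          T.isIntertwining, map_sub, map_smul])
    have hDv : ∀ w, D w = T w - c • w := fun w => rfl
    -- every `Iw`-fixed vector of `W = range D` vanishes
    by_contra hv
    have hDv0 : D v ≠ 0 := by rw [hDv]; exact sub_ne_zero.2 hv
    have hW : D.range ≠ ⊥ := by
      intro h
      have hmem : D v ∈ (D.range).toSubmodule := ⟨v, rfl⟩
      rw [h] at hmem
      exact hDv0 ((Submodule.mem_bot ℂ).1 hmem)
    obtain ⟨f, hfW, hf0, hffix⟩ := K2E3GL3IwahoriFixedOfJacquet.exists_ne_zero_mem_fixedPoints_iwahori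
      (1 : (Π a : Fin 3, GL {i : Fin 3 // (id : Fin 3 → Fin 3) i = a} F) →* ℂˣ) one_unramified hχo D.range hW
    obtain ⟨u, hu⟩ : ∃ u, D u = f := hfW
    apply hf0
    -- `f = e f = e (T u) - c • e u = T (e u) - c • e u = 0`
    have h1 : (Representation.parabolicIndGL F (id : Fin 3 → Fin 3)
        ((Representation.trivial ℂ (Π a : Fin 3, GL {i : Fin 3 // (id : Fin 3 → Fin 3) i = a} F) ℂ).twist 1)).avgProj (iwahoriGL 3 F) f = f :=
      Representation.avgProj_of_forall_apply_eq hK hKo ((Representation.mem_fixedPoints _ _ _).1 hffix)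
    rw [← h1, ← hu, hDv, ← Representation.avgProjLinear_apply (iwahoriGL 3 F) hsm hK, map_sub, map_smul, Representation.avgProjLinear_apply,
      Representation.avgProjLinear_apply, ← K2E3GLnIwahoriHeckeOperators.apply_avgProj_eq_avgProj_apply hK T (hsm u),
      hc _ (Representation.avgProj_mem_fixedPoints hK (hsm u)), sub_self]
  -- (iii) complete reducibility from unitarity of `χ = 1`
  have hss := isSemisimpleRepresentation_parabolicIndGL_twist F (id : Fin 3 → Fin 3)
    (1 : (Π a : Fin 3, GL {i : Fin 3 // (id : Fin 3 → Fin 3) i = a} F) →* ℂˣ)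
    (fun m => by rw [MonoidHom.one_apply, Units.val_one, norm_one]) hχo
  have hcr : ∀ W : Subrepresentation (Representation.parabolicIndGL F (id : Fin 3 → Fin 3)
      ((Representation.trivial ℂ (Π a : Fin 3, GL {i : Fin 3 // (id : Fin 3 → Fin 3) i = a} F) ℂ).twist 1)),
      ∃ W' : Subrepresentation (Representation.parabolicIndGL F (id : Fin 3 → Fin 3)
        ((Representation.trivial ℂ (Π a : Fin 3, GL {i : Fin 3 // (id : Fin 3 → Fin 3) i = a} F) ℂ).twist 1)),
        IsCompl W.toSubmodule W'.toSubmodule := by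
    intro W
    obtain ⟨W', hW'⟩ := exists_isCompl W
    refine ⟨W', ⟨?_, ?_⟩⟩
    · rw [disjoint_iff]
      exact congrArg Subrepresentation.toSubmodule (disjoint_iff.1 hW'.1)
    · rw [codisjoint_iff]
      exact congrArg Subrepresentation.toSubmodule (codisjoint_iff.1 hW'.2)
  -- (iv)
  exact Zelevinsky1980.isIrreducible_of_forall_intertwiningMap_of_exists_isCompl _ hEnd hcr

/-! ## §2 `x × x × x` is irreducible (twist by `x ∘ det`) -/

omit [ValuativeRel F] [TopologicalSpace F] [IsNonarchimedeanLocalField F] in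
/-- `det p = ∏_a det(levi(p)_a)` in `F×` for `p` in the Borel of `GL₃` (`det` of an upper triangular matrix is the product of its diagonal, and the `a`-th `1 × 1` Levi
block of `p` is `(p_{aa})`). [cite: BernsteinZelevinskyASENS1977, §2.1] -/
theorem det_eq_prod_det_leviProjection (p : ↥(standardParabolicGL F (id : Fin 3 → Fin 3))) :
    Matrix.GeneralLinearGroup.det (p : GL (Fin 3) F) =
      ∏ a : Fin 3, Matrix.GeneralLinearGroup.det (leviProjection F (id : Fin 3 → Fin 3) p a) := by
  refine Units.ext ?_
  rw [Matrix.GeneralLinearGroup.val_det_apply, Matrix.det_of_upperTriangular (blockTriangular_of_mem p), Units.coe_prod]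
  refine Finset.prod_congr rfl fun a _ => ?_
  haveI : Unique {i : Fin 3 // (id : Fin 3 → Fin 3) i = a} := ⟨⟨⟨a, rfl⟩⟩, fun x => Subtype.ext x.2⟩
  rw [Matrix.GeneralLinearGroup.val_det_apply, Matrix.det_unique, show (default : {i : Fin 3 // (id : Fin 3 → Fin 3) i = a}) = ⟨a, rfl⟩ from Subsingleton.elim _ _,
    leviProjection_apply_coe]

/-- **`x × x × x` IS IRREDUCIBLE ON `GL₃(F)`** for every character `x : F× → ℂ×` with open kernel — the architect's §3 head `hR1` for the H-layer of leaf (nsc-S-A′):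
`parabolicIndGL F id (𝟙.twist (tch (x,x,x)))` with `tch θ = ∏_a (θ a) ∘ det ∘ ev_a`.  From §1 by the `G`-equivalence `(x∘det) ⊗ (1×1×1) ≅ x×x×x` (★ `SmoothInd.exists_linearEquiv_twist`;
`x(det b) = tch(x,x,x)(levi b)` on `B`) and ★ `isIrreducible_twist_iff` ∕ ★ `Equiv.isIrreducible_iff`. [cite: Zelevinsky1980, Thm. 4.2] [cite: BernsteinZelevinskyASENS1977, 1.9 and Thm. 5.2] -/
theorem isIrreducible_parabolicIndGL_id_three_self (x : Fˣ →* ℂˣ) (hx : IsOpen ((x.ker : Subgroup Fˣ) : Set Fˣ)) :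
    (Representation.parabolicIndGL F (id : Fin 3 → Fin 3)
      ((Representation.trivial ℂ (Π a : Fin 3, GL {i : Fin 3 // (id : Fin 3 → Fin 3) i = a} F) ℂ).twist
        (∏ a : Fin 3, (![x, x, x] a).comp (Matrix.GeneralLinearGroup.det.comp
          (Pi.evalMonoidHom (fun a : Fin 3 => GL {i : Fin 3 // (id : Fin 3 → Fin 3) i = a} F) a))))).IsIrreducible := by
  classical
  -- `θ = x ∘ det` has open kernel
  have hθ : IsOpen (((x.comp (Matrix.GeneralLinearGroup.det : GL (Fin 3) F →* Fˣ)).ker : Subgroup (GL (Fin 3) F)) : Set (GL (Fin 3) F)) := by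
    have : (((x.comp (Matrix.GeneralLinearGroup.det : GL (Fin 3) F →* Fˣ)).ker : Subgroup (GL (Fin 3) F)) : Set (GL (Fin 3) F)) =
        (Matrix.GeneralLinearGroup.det : GL (Fin 3) F →* Fˣ) ⁻¹' ((x.ker : Subgroup Fˣ) : Set Fˣ) := by
      ext g; simp [MonoidHom.mem_ker]
    rw [this]
    exact hx.preimage Matrix.GeneralLinearGroup.continuous_det
  -- the inducing data agree: `(σ₁ ⊗ θ|_B) = σ_x`
  have hσ : (Representation.twist (((Representation.trivial ℂ (Π a : Fin 3, GL {i : Fin 3 // (id : Fin 3 → Fin 3) i = a} F) ℂ).twist 1).comp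
        (leviProjection F (id : Fin 3 → Fin 3))) (rootDeltaChar (standardParabolicGL F (id : Fin 3 → Fin 3)))).twist
        ((x.comp (Matrix.GeneralLinearGroup.det : GL (Fin 3) F →* Fˣ)).comp (standardParabolicGL F (id : Fin 3 → Fin 3)).subtype) =
      Representation.twist (((Representation.trivial ℂ (Π a : Fin 3, GL {i : Fin 3 // (id : Fin 3 → Fin 3) i = a} F) ℂ).twist
        (∏ a : Fin 3, (![x, x, x] a).comp (Matrix.GeneralLinearGroup.det.comp
          (Pi.evalMonoidHom (fun a : Fin 3 => GL {i : Fin 3 // (id : Fin 3 → Fin 3) i = a} F) a)))).comp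
        (leviProjection F (id : Fin 3 → Fin 3))) (rootDeltaChar (standardParabolicGL F (id : Fin 3 → Fin 3))) := by
    refine MonoidHom.ext fun b => LinearMap.ext fun z => ?_
    simp only [Representation.twist_apply, MonoidHom.comp_apply, Representation.trivial_apply, MonoidHom.one_apply, Units.val_one, one_smul,
      Subgroup.coe_subtype, MonoidHom.finsetProd_apply, Pi.evalMonoidHom_apply, smul_smul]
    congr 1
    rw [mul_comm, det_eq_prod_det_leviProjection, map_prod, Units.coe_prod, Units.coe_prod]
    refine congrArg _ (Finset.prod_congr rfl fun a _ => ?_)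
    fin_cases a <;> rfl
  -- the `G`-equivalence `(1×1×1) ⊗ θ ≅ Ind (σ₁ ⊗ θ|_B)`
  obtain ⟨e, -, he⟩ := SmoothInd.exists_linearEquiv_twist (standardParabolicGL F (id : Fin 3 → Fin 3))
    (Representation.twist (((Representation.trivial ℂ (Π a : Fin 3, GL {i : Fin 3 // (id : Fin 3 → Fin 3) i = a} F) ℂ).twist 1).comp
      (leviProjection F (id : Fin 3 → Fin 3))) (rootDeltaChar (standardParabolicGL F (id : Fin 3 → Fin 3))))
    (x.comp (Matrix.GeneralLinearGroup.det : GL (Fin 3) F →* Fˣ)) hθ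
  have E := Representation.Equiv.mk (ρ := (Representation.parabolicIndGL F (id : Fin 3 → Fin 3)
      ((Representation.trivial ℂ (Π a : Fin 3, GL {i : Fin 3 // (id : Fin 3 → Fin 3) i = a} F) ℂ).twist 1)).twist
        (x.comp (Matrix.GeneralLinearGroup.det : GL (Fin 3) F →* Fˣ)))
    (σ := Representation.smoothIndRep (standardParabolicGL F (id : Fin 3 → Fin 3))
      ((Representation.twist (((Representation.trivial ℂ (Π a : Fin 3, GL {i : Fin 3 // (id : Fin 3 → Fin 3) i = a} F) ℂ).twist 1).comp
        (leviProjection F (id : Fin 3 → Fin 3))) (rootDeltaChar (standardParabolicGL F (id : Fin 3 → Fin 3)))).twist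
        ((x.comp (Matrix.GeneralLinearGroup.det : GL (Fin 3) F →* Fˣ)).comp (standardParabolicGL F (id : Fin 3 → Fin 3)).subtype)))
    e (fun g => LinearMap.ext fun f => by
      rw [LinearMap.comp_apply, LinearMap.comp_apply, LinearEquiv.coe_coe, Representation.twist_apply]
      exact he g f)
  haveI := isIrreducible_parabolicIndGL_id_three_one (F := F)
  have h1 := ((Representation.parabolicIndGL F (id : Fin 3 → Fin 3)
      ((Representation.trivial ℂ (Π a : Fin 3, GL {i : Fin 3 // (id : Fin 3 → Fin 3) i = a} F) ℂ).twist 1)).isIrreducible_twist_iff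
        (x.comp (Matrix.GeneralLinearGroup.det : GL (Fin 3) F →* Fˣ))).2 ‹_›
  have h2 := (Representation.Equiv.isIrreducible_iff E).1 h1
  unfold Representation.parabolicIndGL
  rw [← hσ]
  exact h2

end Summit.HodgeConjecture.HodgeConjecture.Cruxes.H413.K2E3GL3UnitaryPrincipalSeriesIrregular

end
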